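import Literature.NumberTheory.Weil1965.SplitPlaceFibreDensity
import Literature.NumberTheory.Weil1965.SplitPlaceFibreDensityScaling
import HarnessLib

/-!
# Split-place fibre DENSITIES of the dot product: invariance under `(g, g′)` and homogeneity under `(t, t′)`
# (Weil 1965, n° 37 / n° 50 (36)–(40) at a split place — the limit forms)

Topic `NumberTheory/Weil1965`; namespace `Literature.NumberTheory.Weil1965.SplitPlace`.  THEOREMS ONLY (no definition, no
instance, no notation, no named fact, no `sorry`).  Sequel of ★ `SplitPlaceFibreDensityScaling` (row SW2c-SCAL: the
finite-level identities for the fibre AVERAGES `fibreAvg μ Φ b r`, stated there with `fibreAvg` unfolded) over ★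
`SplitPlaceFibreDensity` (F0P2a-p08 (g4), FILE A: `fibreAvg`, `fibreDensity`, and the convergence `tendsto_fibreAvg` of the
averages to the density for Schwartz–Bruhat `Φ` and every `b`, `2 ≤ |ι|`).  Passing to the limit `r → ∞`
(`tendsto_nhds_unique`):

* `fibreAvg_comp_dual_eq`, **`fibreDensity_comp_dual`** — `F_{Φ ∘ (g × g′)}(b) = F_Φ(b)` for `g x ⬝ᵥ g′ y = x ⬝ᵥ y`
  ([Weil1965] n° 37: the local measure `μ_{b,v} = |θ_b|_v` is invariant under `G'_v = U(V)(F_v) ≅ GL_N(F_v)`);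
* **`fibreDensity_comp_smul`** — `F_{Φ ∘ (t, t′)}(b) = ‖tt′‖ · (‖tt′‖^{|ι|})⁻¹ · F_Φ(tt′ b)` for `t t′ ≠ 0`
  ([Weil1965] n° 50 (36)–(40): the torus scaling at the one split place of the boundedness endgame of Thm 4).

Cell `hodgecm-mathlib`, programme P4, ENGINE E-2 (H413), child line `F0_E2SiegelWeilWeilRange`, stub `stub_SW2_siegelWeil`,
identity road (W).  HC_CM is proved only modulo the 7 printed citations until rung 0 closes — nothing here bears on a summit
statement.

## References
* [Weil1965] A. Weil, *Sur la formule de Siegel dans la théorie des groupes classiques*, Acta Math. 113 (1965) 1–87: n° 37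
  Prop. 6 (p. 54), n° 44 Thm 2 (p. 63), n° 50 Thm 4 ((36)–(40), pp. 72–74).
-/

set_option autoImplicit false

noncomputable section

open MeasureTheory ValuativeRel Filter Topology Set Matrix
open scoped NNReal ENNReal Pointwise Matrix
open Literature.NumberTheory.GaloisRepresentations.IsNonarchimedeanLocalField
open Literature.NumberTheory.Automorphic
open Literature.NumberTheory.Weil1964

namespace Literature.NumberTheory.Weil1965.SplitPlace

variable {K : Type*} [Field K] [ValuativeRel K] [TopologicalSpace K] [IsNonarchimedeanLocalField K]
variable {ι : Type*} [Fintype ι] [MeasurableSpace K] [BorelSpace K] (μ : Measure K) [μ.IsAddHaarMeasure]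

omit [MeasurableSpace K] [BorelSpace K] in
/-- `‖c‖ = q^{-k}` forces `c ≠ 0`. [folklore] -/
private theorem ne_zero_of_normAbs_eq_zpow' {c : K} {k : ℤ} (hc : normAbs K c = ((residueFieldCard K : ℝ≥0)⁻¹) ^ k) :
    c ≠ 0 := by
  rintro rfl
  rw [map_zero] at hc
  exact (zpow_pos inv_residueFieldCard_pos k).ne hc

/-! ## §1 Invariance under the dual pairs `(g, g′)`, `g x ⬝ᵥ g′ y = x ⬝ᵥ y` -/

/-- **The fibre averages of `Φ ∘ (g × g′)` and `Φ` agree** (FILE A's `fibreAvg`; ★ `fibreAvg_comp_dual` folded).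
[cite: Weil1965, n° 37 (p. 54)] -/
theorem fibreAvg_comp_dual_eq (g g' : (ι → K) ≃ₗ[K] (ι → K)) (hgg' : ∀ x y, g x ⬝ᵥ g' y = x ⬝ᵥ y)
    (Φ : (ι → K) × (ι → K) → ℂ) (b : K) (r : ℤ) :
    fibreAvg μ (fun z => Φ (g z.1, g' z.2)) b r = fibreAvg μ Φ b r :=
  fibreAvg_comp_dual μ g g' hgg' Φ b r

/-- **`G'_v`-INVARIANCE OF THE FIBRE DENSITY**: `F_{Φ ∘ (g × g′)}(b) = F_Φ(b)` for Schwartz–Bruhat `Φ`, every `b ∈ K`, and every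
dual pair `(g, g′)` of automorphisms of `K^ι` (`g x ⬝ᵥ g′ y = x ⬝ᵥ y` — the action of `U(V)(F_v) ≅ GL_N(F_v)` on
`V_v = K^ι × K^ι`): both sides are limits of the same averages. [cite: Weil1965, n° 37 (p. 54)] [cite: Weil1965, n° 44 Thm 2 (p. 63)] -/
theorem fibreDensity_comp_dual [Nonempty ι] [DecidableEq ι] [MeasurableSingletonClass K] (hι : 2 ≤ Fintype.card ι)
    {Φ : (ι → K) × (ι → K) → ℂ} (hΦ : Φ ∈ SchwartzBruhat ((ι → K) × (ι → K)))
    (g g' : (ι → K) ≃ₗ[K] (ι → K)) (hgg' : ∀ x y, g x ⬝ᵥ g' y = x ⬝ᵥ y) (b : K) :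
    fibreDensity μ (fun z => Φ (g z.1, g' z.2)) b = fibreDensity μ Φ b := by
  have h1 := tendsto_fibreAvg μ hι (schwartzBruhat_comp_prodMap_linearEquiv g g' hΦ) b
  simp_rw [fibreAvg_comp_dual_eq μ g g' hgg' Φ b] at h1
  exact tendsto_nhds_unique h1 (tendsto_fibreAvg μ hι hΦ b)

/-! ## §2 Homogeneity under `(x, y) ↦ (t x, t′ y)` -/

/-- **TORUS SCALING OF THE FIBRE DENSITY AT A SPLIT PLACE** [Weil1965 n° 50, (36)–(40)]: for Schwartz–Bruhat `Φ`, `b ∈ K` and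
`t, t′ ∈ K` with `‖tt′‖ = q^{-k}` (any `k : ℤ`, i.e. `tt′ ≠ 0`),
`F_{Φ∘(t,t′)}(b) = ‖tt′‖ · (‖tt′‖^{|ι|})⁻¹ · F_Φ(tt′ b)` — the averages of `Φ ∘ (t, t′)` at level `r` are `‖tt′‖^{1−|ι|}` times
those of `Φ` at `tt′b` and level `r + k` (★ `tendsto_fibreAvg_comp_smul`), and both converge (FILE A `tendsto_fibreAvg`).
[cite: Weil1965, n° 50 Thm 4 (pp. 72–74)] [cite: Weil1965, n° 44 Thm 2 (p. 63)] -/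
theorem fibreDensity_comp_smul [Nonempty ι] [DecidableEq ι] [MeasurableSingletonClass K] (hι : 2 ≤ Fintype.card ι)
    {Φ : (ι → K) × (ι → K) → ℂ} (hΦ : Φ ∈ SchwartzBruhat ((ι → K) × (ι → K)))
    {t t' : K} {k : ℤ} (hc : normAbs K (t * t') = ((residueFieldCard K : ℝ≥0)⁻¹) ^ k) (b : K) :
    fibreDensity μ (fun z => Φ (t • z.1, t' • z.2)) b =
      ((normAbs K (t * t') : ℝ) : ℂ) * (((normAbs K (t * t') : ℝ) : ℂ) ^ Fintype.card ι)⁻¹ *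
        fibreDensity μ Φ ((t * t') * b) := by
  have hc0 : t * t' ≠ 0 := ne_zero_of_normAbs_eq_zpow' hc
  have ht : t ≠ 0 := left_ne_zero_of_mul hc0
  have ht' : t' ≠ 0 := right_ne_zero_of_mul hc0
  -- `Φ ∘ (t, t′)` is Schwartz–Bruhat: `(t • ·, t′ • ·) = (e₁, e₂)` for the scalar automorphisms
  have hΦ' : (fun z : (ι → K) × (ι → K) => Φ (t • z.1, t' • z.2)) ∈ SchwartzBruhat ((ι → K) × (ι → K)) :=
    schwartzBruhat_comp_prodMap_linearEquiv (LinearEquiv.smulOfUnit (Units.mk0 t ht))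
      (LinearEquiv.smulOfUnit (Units.mk0 t' ht')) hΦ
  exact tendsto_nhds_unique (tendsto_fibreAvg μ hι hΦ' b)
    (tendsto_fibreAvg_comp_smul μ hc Φ b (tendsto_fibreAvg μ hι hΦ ((t * t') * b)))

/-- The same with `‖tt′‖` read through `k`: `F_{Φ∘(t,t′)}(b) = (q⁻¹)^k · ((q⁻¹)^{k|ι|})⁻¹ · F_Φ(tt′b)`, i.e. the factor is
`q^{k(|ι|−1)}`. [cite: Weil1965, n° 50 Thm 4 (pp. 72–74)] -/
theorem fibreDensity_comp_smul' [Nonempty ι] [DecidableEq ι] [MeasurableSingletonClass K] (hι : 2 ≤ Fintype.card ι)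
    {Φ : (ι → K) × (ι → K) → ℂ} (hΦ : Φ ∈ SchwartzBruhat ((ι → K) × (ι → K)))
    {t t' : K} {k : ℤ} (hc : normAbs K (t * t') = ((residueFieldCard K : ℝ≥0)⁻¹) ^ k) (b : K) :
    fibreDensity μ (fun z => Φ (t • z.1, t' • z.2)) b =
      ((((residueFieldCard K : ℝ≥0)⁻¹) ^ k : ℝ≥0) : ℂ) * (((((residueFieldCard K : ℝ≥0)⁻¹) ^ k : ℝ≥0) : ℂ) ^ Fintype.card ι)⁻¹ *
        fibreDensity μ Φ ((t * t') * b) := by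
  rw [fibreDensity_comp_smul μ hι hΦ hc b, hc]

end Literature.NumberTheory.Weil1965.SplitPlace

end
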